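import Summits.ValiantsHypothesis.ValiantsHypothesis.Theses.DivisionGap
import Literature.Barriers.ValiantsHypothesis.MonotoneGapProofs
import Literature.Computability.AlgebraicComplexity.ArithCircuitProofs

/-!
# `ZeroOneTransfer` — negative-side infrastructure: killing rows of `ST` and Jerrum–Snir by support

Crux `stmt-ValiantsHypothesis-5066` (`Theses.DivisionGap.ZeroOneTransfer`, route DivisionGap).
Standing disprover (cdisprove), `Cruxes/ZeroOneTransfer/Disproof.lean` §(B2); consumed by
`LowDegreeCofactor.lean` (low-degree cofactors do not help `ST`).

* `isArborescence_iff_exists_rank` — arborescences = parent maps with a strictly decreasing rank.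
* `killRows R e` — the projection rows `R ↦ 1`, pointers into `R ↦ 0`, the rest renamed to
  `Fin M ≃ {i ∉ R}`; `support_aeval_killRows_stPoly`: it maps `ST_N` onto a polynomial with the
  SUPPORT of `ST_M` (`shrink` / `lift` of arborescences); `aeval_killRows_eq_C`: a polynomial
  living on the rows of `R` becomes a nonzero constant.
* `two_rpow_le_complexity_of_support_eq` — Jerrum–Snir's `2^{M/20} ≤ L_{ℝ≥0}(p)` for EVERY `p`
  with the support of `ST_M`, `M ≥ 60` (the tree's argument, `JerrumSnir1982_spanningTree_holds`,
  is support-only; re-run verbatim).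
[folklore] [cite: JerrumSnir1982, §4.5 and §5.1]
-/

namespace Summit.ValiantsHypothesis.ValiantsHypothesis.Theorems.ZeroOneTransfer.Negative

open Literature.Computability.AlgebraicComplexity Literature.Barriers.ValiantsHypothesis
open MvPolynomial Finset
open scoped NNReal

noncomputable section

/-! ### Rank characterisation of arborescences -/

section Arborescence

variable {N : ℕ}

/-- **Arborescences are the parent maps admitting a strictly decreasing rank** along parent
pointers (rank = distance to the root). [folklore] -/
theorem isArborescence_iff_exists_rank (t : Fin N → Option (Fin N)) :
    IsArborescence t ↔ ∃ rk : Fin N → ℕ, ∀ i j, t i = some j → rk j < rk i := by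
  classical
  constructor
  · intro ht
    refine ⟨fun i => Nat.find (ht i), fun i j hij => ?_⟩
    have hi := Nat.find_spec (ht i)
    obtain ⟨r, hr⟩ : ∃ r, Nat.find (ht i) = r + 1 := by
      rcases h0 : Nat.find (ht i) with _ | r
      · rw [h0] at hi
        simp at hi
      · exact ⟨r, rfl⟩
    rw [hr, Function.iterate_succ_apply, parentMap_some, hij] at hi
    calc Nat.find (ht j) ≤ r := Nat.find_le hi
      _ < Nat.find (ht i) := by rw [hr]; exact Nat.lt_succ_self r
  · rintro ⟨rk, hrk⟩
    suffices h : ∀ n, ∀ i : Fin N, rk i < n → ∃ r, (parentMap t)^[r] (some i) = none from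
      fun i => h _ i (Nat.lt_succ_self _)
    intro n
    induction n with
    | zero => intro i hi; exact absurd hi (Nat.not_lt_zero _)
    | succ n ih =>
      intro i hi
      cases hti : t i with
      | none => exact ⟨1, by simp [hti]⟩
      | some j =>
        obtain ⟨r, hr⟩ := ih j (by have := hrk i j hti; omega)
        exact ⟨r + 1, by rw [Function.iterate_succ_apply, parentMap_some, hti, hr]⟩

variable (R : Finset (Fin N)) {M : ℕ} (e : {i : Fin N // i ∉ R} ≃ Fin M)

/-- Shrink a parent map on `Fin N` whose pointers into `R` come only from `R` to a parent map on
`Fin M ≃ {i ∉ R}` (pointers into `R` — absent in the intended use — are sent to the root). [folklore] -/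
def shrink (t : Fin N → Option (Fin N)) : Fin M → Option (Fin M) := fun k =>
  match t (e.symm k).1 with
  | none => none
  | some j => if hj : j ∈ R then none else some (e ⟨j, hj⟩)

/-- Lift a parent map on `Fin M` to `Fin N`: the rows of `R` point to the root. [folklore] -/
def lift (s : Fin M → Option (Fin M)) : Fin N → Option (Fin N) := fun i =>
  if hi : i ∈ R then none else (s (e ⟨i, hi⟩)).map fun k => (e.symm k).1

/-- `shrink` at a row pointing to the root. [folklore] -/
theorem shrink_apply_of_eq_none {t : Fin N → Option (Fin N)} {k : Fin M}
    (h : t (e.symm k).1 = none) : shrink R e t k = none := by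
  simp [shrink, h]

/-- `shrink` at a row pointing outside `R`. [folklore] -/
theorem shrink_apply_of_eq_some {t : Fin N → Option (Fin N)} {k : Fin M} {j : Fin N}
    (h : t (e.symm k).1 = some j) (hj : j ∉ R) : shrink R e t k = some (e ⟨j, hj⟩) := by
  simp [shrink, h, hj]

/-- In a lift, pointers into `R` come only from `R` (in fact there are none). [folklore] -/
theorem lift_pointer (s : Fin M → Option (Fin M)) (i j : Fin N) (h : lift R e s i = some j) :
    j ∉ R ∧ i ∉ R := by
  unfold lift at h
  by_cases hi : i ∈ R
  · simp [hi] at h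
  · simp only [hi, dite_false] at h
    cases hs : s (e ⟨i, hi⟩) with
    | none => rw [hs] at h; simp at h
    | some k =>
      rw [hs, Option.map_some] at h
      have := Option.some_injective _ h
      exact ⟨this ▸ (e.symm k).2, hi⟩

/-- `shrink ∘ lift = id`. [folklore] -/
theorem shrink_lift (s : Fin M → Option (Fin M)) : shrink R e (lift R e s) = s := by
  funext k
  have hk : (e.symm k).1 ∉ R := (e.symm k).2
  have hlift : lift R e s (e.symm k).1 = (s k).map fun k' => (e.symm k').1 := by
    unfold lift
    rw [dif_neg hk]
    simp
  cases hs : s k with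
  | none =>
    rw [hs, Option.map_none] at hlift
    exact shrink_apply_of_eq_none R e hlift
  | some k2 =>
    rw [hs, Option.map_some] at hlift
    rw [shrink_apply_of_eq_some R e hlift (e.symm k2).2]
    simp

/-- Lifts of arborescences are arborescences. [folklore] -/
theorem isArborescence_lift {s : Fin M → Option (Fin M)} (hs : IsArborescence s) :
    IsArborescence (lift R e s) := by
  classical
  rw [isArborescence_iff_exists_rank] at hs ⊢
  obtain ⟨rk, hrk⟩ := hs
  refine ⟨fun i => if hi : i ∈ R then 0 else rk (e ⟨i, hi⟩) + 1, fun i j hij => ?_⟩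
  obtain ⟨hj, hi⟩ := lift_pointer R e s i j hij
  unfold lift at hij
  rw [dif_neg hi] at hij
  cases hsk : s (e ⟨i, hi⟩) with
  | none => rw [hsk] at hij; simp at hij
  | some k =>
    rw [hsk, Option.map_some] at hij
    have hjk : j = (e.symm k).1 := (Option.some_injective _ hij).symm
    have hek : e ⟨j, hj⟩ = k := by
      rw [Equiv.apply_eq_iff_eq_symm_apply]; exact Subtype.ext hjk
    simp only [dif_neg hi, dif_neg hj, hek]
    have := hrk _ _ hsk
    omega

/-- Shrinks of arborescences whose pointers into `R` come only from `R` are arborescences.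
[folklore] -/
theorem isArborescence_shrink {t : Fin N → Option (Fin N)} (ht : IsArborescence t)
    (hP : ∀ i j, t i = some j → j ∈ R → i ∈ R) : IsArborescence (shrink R e t) := by
  classical
  rw [isArborescence_iff_exists_rank] at ht ⊢
  obtain ⟨rk, hrk⟩ := ht
  refine ⟨fun k => rk (e.symm k).1, fun k k2 hk => ?_⟩
  cases htk : t (e.symm k).1 with
  | none => rw [shrink_apply_of_eq_none R e htk] at hk; simp at hk
  | some j =>
    have hj : j ∉ R := fun hj => (e.symm k).2 (hP _ _ htk hj)
    rw [shrink_apply_of_eq_some R e htk hj] at hk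
    have hk2 : k2 = e ⟨j, hj⟩ := (Option.some_injective _ hk).symm
    subst hk2
    simp only [Equiv.symm_apply_apply]
    exact hrk _ _ htk

end Arborescence

/-! ### The projection killing the rows `R` -/

section Projection

variable {N : ℕ} (R : Finset (Fin N)) {M : ℕ} (e : {i : Fin N // i ∉ R} ≃ Fin M)

/-- The substitution: rows in `R` ↦ `1`; a pointer from outside `R` into `R` ↦ `0`; the
remaining variables are renamed to `Fin M × Option (Fin M)`. [folklore] -/
def killRows : Fin N × Option (Fin N) → MvPolynomial (Fin M × Option (Fin M)) ℝ≥0 := fun v =>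
  if hi : v.1 ∈ R then 1 else
    match v.2 with
    | none => X (e ⟨v.1, hi⟩, none)
    | some j => if hj : j ∈ R then 0 else X (e ⟨v.1, hi⟩, some (e ⟨j, hj⟩))

/-- `killRows` is a projection (every value is a variable or a constant). [folklore] -/
theorem isProjection_killRows (p : MvPolynomial (Fin N × Option (Fin N)) ℝ≥0) :
    IsProjection (aeval (killRows R e) p) p := by
  refine ⟨killRows R e, fun v => ?_, rfl⟩
  unfold killRows
  by_cases hi : v.1 ∈ R
  · right; exact ⟨1, by simp [hi]⟩
  · rcases v with ⟨i, _ | j⟩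
    · simp only at hi
      left; exact ⟨(e ⟨i, hi⟩, none), by simp [hi]⟩
    · simp only at hi
      by_cases hj : j ∈ R
      · right; exact ⟨0, by simp [hi, hj]⟩
      · left; exact ⟨(e ⟨i, hi⟩, some (e ⟨j, hj⟩)), by simp [hi, hj]⟩

/-- The value of the monomial of a parent map `t` under `killRows`: zero if some row outside
`R` points into `R`, otherwise the monomial of the shrunk map. [folklore] -/
theorem prod_killRows (t : Fin N → Option (Fin N)) :
    ∏ i : Fin N, killRows R e (i, t i) =
      if (∀ i j, t i = some j → j ∈ R → i ∈ R) then
        ∏ k : Fin M, (X (k, shrink R e t k) : MvPolynomial (Fin M × Option (Fin M)) ℝ≥0)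
      else 0 := by
  classical
  -- split the product over `R` and its complement
  have hsplit : ∏ i : Fin N, killRows R e (i, t i) =
      ∏ x : {i : Fin N // i ∉ R}, killRows R e (x.1, t x.1) := by
    rw [← Fintype.prod_subtype_mul_prod_subtype (fun i : Fin N => i ∈ R)
      (fun i => killRows R e (i, t i))]
    rw [Finset.prod_eq_one (fun x _ => by simp [killRows, x.2]), one_mul]
  rw [hsplit]
  split_ifs with hP
  · refine Fintype.prod_equiv e _ _ fun x => ?_
    have hx : x.1 ∉ R := x.2
    cases htx : t x.1 with
    | none =>
      have h1 : shrink R e t (e x) = none :=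
        shrink_apply_of_eq_none R e (by simpa using htx)
      rw [h1]; simp [killRows, hx]
    | some j =>
      have hj : j ∉ R := fun hj => hx (hP _ _ htx hj)
      have h1 : shrink R e t (e x) = some (e ⟨j, hj⟩) :=
        shrink_apply_of_eq_some R e (by simpa using htx) hj
      rw [h1]; simp [killRows, hx, hj]
  · push Not at hP
    obtain ⟨i, j, hij, hj, hi⟩ := hP
    apply Finset.prod_eq_zero (Finset.mem_univ ⟨i, hi⟩)
    simp [killRows, hi, hij, hj]

/-- `ST_N` under `killRows`: the sum, over arborescences whose pointers into `R` come only from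
`R`, of the monomials of their shrinks. [folklore] -/
theorem aeval_killRows_stPoly :
    aeval (killRows R e) (stPoly ℝ≥0 N) =
      ∑ t ∈ (arborescences N).filter (fun t => ∀ i j, t i = some j → j ∈ R → i ∈ R),
        monomial (arbMonomial (shrink R e t)) (1 : ℝ≥0) := by
  classical
  rw [stPoly_eq_sum_monomial]
  simp only [map_sum]
  rw [Finset.sum_filter]
  refine Finset.sum_congr rfl fun t _ => ?_
  rw [← prod_X_arb_eq_monomial, map_prod]
  simp only [aeval_X]
  rw [prod_killRows, ← prod_X_arb_eq_monomial]

/-- Over `ℝ≥0` the support of a sum of coefficient-one monomials is the image. [folklore] -/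
theorem support_sum_monomial_one {ι τ : Type*} [DecidableEq τ] (S : Finset ι) (m : ι → τ →₀ ℕ) :
    (∑ t ∈ S, monomial (m t) (1 : ℝ≥0) : MvPolynomial τ ℝ≥0).support = S.image m := by
  classical
  ext d
  rw [mem_support_iff, coeff_sum, Finset.mem_image]
  simp only [coeff_monomial]
  rw [Finset.sum_boole]
  constructor
  · intro h
    have : (S.filter fun t => m t = d).Nonempty := by
      by_contra hne
      rw [Finset.not_nonempty_iff_eq_empty] at hne
      exact h (by rw [hne]; simp)
    obtain ⟨t, ht⟩ := this
    exact ⟨t, (Finset.mem_filter.mp ht).1, (Finset.mem_filter.mp ht).2⟩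
  · rintro ⟨t, ht, htd⟩
    have hpos : 0 < (S.filter fun t => m t = d).card :=
      Finset.card_pos.mpr ⟨t, Finset.mem_filter.mpr ⟨ht, htd⟩⟩
    exact_mod_cast hpos.ne'

/-- **The support of `ST_N` under `killRows` is the support of `ST_M`.** [folklore] -/
theorem support_aeval_killRows_stPoly :
    (aeval (killRows R e) (stPoly ℝ≥0 N)).support = (stPoly ℝ≥0 M).support := by
  classical
  rw [aeval_killRows_stPoly, support_sum_monomial_one, support_stPoly]
  ext d
  simp only [Finset.mem_image, Finset.mem_filter, mem_arborescences]
  constructor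
  · rintro ⟨t, ⟨ht, hP⟩, rfl⟩
    exact ⟨shrink R e t, isArborescence_shrink R e ht hP, rfl⟩
  · rintro ⟨s, hs, rfl⟩
    refine ⟨lift R e s, ⟨isArborescence_lift R e hs, fun i j hij hj => ?_⟩, by rw [shrink_lift]⟩
    exact absurd hj (lift_pointer R e s i j hij).1

/-- A polynomial all of whose variables lie in the rows `R` becomes a nonzero constant under
`killRows`. [folklore] -/
theorem aeval_killRows_eq_C {p : MvPolynomial (Fin N × Option (Fin N)) ℝ≥0}
    (hp : ∀ d ∈ p.support, ∀ v ∈ d.support, v.1 ∈ R) :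
    aeval (killRows R e) p = C (∑ d ∈ p.support, coeff d p) := by
  classical
  conv_lhs => rw [p.as_sum]
  rw [map_sum, map_sum]
  refine Finset.sum_congr rfl fun d hd => ?_
  rw [aeval_monomial, ← C_eq_algebraMap]
  suffices h : (d.prod fun v k => killRows R e v ^ k) = 1 by rw [h, mul_one]
  refine Finset.prod_eq_one fun v hv => ?_
  have : killRows R e v = 1 := by simp [killRows, hp d hd v hv]
  show killRows R e v ^ (d v) = 1
  rw [this, one_pow]

/-- Over `ℝ≥0` the sum of the coefficients of a nonzero polynomial is nonzero. [folklore] -/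
theorem sum_coeff_ne_zero {τ : Type*} {p : MvPolynomial τ ℝ≥0} (hp : p ≠ 0) :
    ∑ d ∈ p.support, coeff d p ≠ 0 := by
  obtain ⟨d, hd⟩ := exists_coeff_ne_zero hp
  intro h
  rw [Finset.sum_eq_zero_iff] at h
  exact hd (h d (mem_support_iff.mpr hd))

end Projection

/-! ### Jerrum–Snir for every polynomial with the support of `ST` -/

section SupportBound

/-- **Jerrum–Snir by support.**  Every fan-in-two circuit over `ℝ≥0` computing a polynomial
with the same SUPPORT as `ST_M`, `M ≥ 60`, has at least `2^{M/20}` product gates (the tree's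
argument is support-only). [cite: JerrumSnir1982, §4.5 and §5.1] -/
theorem two_rpow_le_prodCount_of_support_eq {M : ℕ} (hM : 60 ≤ M)
    {p : MvPolynomial (Fin M × Option (Fin M)) ℝ≥0} (hp : p.support = (stPoly ℝ≥0 M).support)
    {P : ArithCircuit ℝ≥0 (Fin M × Option (Fin M))} (hP2 : P.IsFanInTwo)
    (hP : P.Computes p) : (2 : ℝ) ^ ((1 / 20 : ℝ) * M) ≤ prodCount P := by
  classical
  have heval : P.eval = p := hP
  have hhom : p.IsHomogeneous M := by
    intro d hd
    have hd' : d ∈ (stPoly ℝ≥0 M).support := hp ▸ mem_support_iff.mpr hd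
    exact stPoly_isHomogeneous ℝ≥0 M (mem_support_iff.mp hd')
  -- (1) the balanced decomposition with `m = ⌊M/3⌋`
  have hm1 : 1 ≤ M / 3 := by omega
  have hmN : M / 3 < M := by omega
  obtain ⟨L, hLlen, hLsum, hLdeg⟩ :=
    Literature.Barriers.ValiantsHypothesis.exists_decomposition hm1 hmN _ P le_rfl hP2
      (by rw [heval]; exact hhom)
  rw [heval] at hLsum
  -- (2) every product has few monomials
  have hN1 : 1 ≤ M := by omega
  have hNpos : (0 : ℝ) < M := by exact_mod_cast hN1
  set r : ℝ := (9 + 8 * M) / 9 with hr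
  have hrpos : 0 < r := by positivity
  have hterm : ∀ ab ∈ L, ((ab.1 * ab.2).support.card : ℝ) ≤ r ^ M := by
    intro ab hab
    by_cases hb : ab.2 = 0
    · simp only [hb, mul_zero, support_zero, card_empty, Nat.cast_zero]
      positivity
    have hdeg := hLdeg ab hab
    have ha : ab.1 ≠ 0 := by
      intro ha
      rw [ha, totalDegree_zero] at hdeg
      omega
    have hsub : (ab.1 * ab.2).support ⊆ (stPoly ℝ≥0 M).support := by
      obtain ⟨q, hq⟩ := exists_sum_eq_add_of_mem (fun ab : MvPolynomial _ ℝ≥0 × _ => ab.1 * ab.2)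
        L ab hab
      rw [← hp]
      exact support_subset_of_eq_add (hLsum.trans hq)
    obtain ⟨hkN, hcard⟩ := card_support_mul_le hN1 hsub ha hb
    refine hcard.trans (pow_le_pow_left₀ (by positivity) ?_ M)
    have hT := nine_mul_bound_le hdeg.1 hdeg.2
    rw [div_le_iff₀ hNpos, hr]
    have hT' : (9 : ℝ) * ((M + ab.1.totalDegree ^ 2 + (M - ab.1.totalDegree) ^ 2 +
        ab.1.totalDegree * (M - ab.1.totalDegree) : ℕ) : ℝ) ≤ 9 * M + 8 * (M : ℝ) ^ 2 := by
      exact_mod_cast hT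
    nlinarith [hT']
  -- (3) counting monomials
  have hcount : ((M : ℝ) + 1) ^ (M - 1) ≤ prodCount P * r ^ M := by
    have h1 := card_support_sum_le L (r ^ M) hterm
    rw [← hLsum, hp, card_support_stPoly_eq] at h1
    push_cast at h1
    refine h1.trans ?_
    gcongr
  -- (4) arithmetic
  have hq : (28 / 25 : ℝ) ≤ 9 * ((M : ℝ) + 1) / (9 + 8 * M) := ratio_ge (by omega)
  have hqr : 9 * ((M : ℝ) + 1) / (9 + 8 * M) * r = M + 1 := by
    rw [hr]; field_simp
  have hkey : (2 : ℝ) ^ ((1 / 20 : ℝ) * M) * ((M : ℝ) + 1) * r ^ M ≤ ((M : ℝ) + 1) ^ M := by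
    calc (2 : ℝ) ^ ((1 / 20 : ℝ) * M) * ((M : ℝ) + 1) * r ^ M
        ≤ (26 / 25 : ℝ) ^ M * (14 / 13 : ℝ) ^ M * r ^ M := by
          gcongr
          · exact two_rpow_div_twenty_le M
          · exact succ_le_pow_of_sixty_le hM
      _ = (28 / 25 : ℝ) ^ M * r ^ M := by rw [← mul_pow]; norm_num
      _ ≤ (9 * ((M : ℝ) + 1) / (9 + 8 * M)) ^ M * r ^ M := by gcongr
      _ = ((M : ℝ) + 1) ^ M := by rw [← mul_pow, hqr]
  have hpow : ((M : ℝ) + 1) ^ M = ((M : ℝ) + 1) * ((M : ℝ) + 1) ^ (M - 1) := by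
    rw [← pow_succ']; congr 1; omega
  rw [hpow] at hkey
  have hN1' : (0 : ℝ) < (M : ℝ) + 1 := by positivity
  have h5 : (2 : ℝ) ^ ((1 / 20 : ℝ) * M) * r ^ M ≤ ((M : ℝ) + 1) ^ (M - 1) := by
    have := hkey
    rw [mul_comm ((2 : ℝ) ^ _) ((M : ℝ) + 1), mul_assoc] at this
    exact le_of_mul_le_mul_left this hN1'
  have h6 : (2 : ℝ) ^ ((1 / 20 : ℝ) * M) * r ^ M ≤ prodCount P * r ^ M := h5.trans hcount
  exact le_of_mul_le_mul_right h6 (pow_pos hrpos M)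

/-- Hence `2^{M/20} ≤ L_{ℝ≥0}(p)` for every `p` with the support of `ST_M`, `M ≥ 60`.
[cite: JerrumSnir1982, §4.5 and §5.1] -/
theorem two_rpow_le_complexity_of_support_eq {M : ℕ} (hM : 60 ≤ M)
    {p : MvPolynomial (Fin M × Option (Fin M)) ℝ≥0}
    (hp : p.support = (stPoly ℝ≥0 M).support) :
    (2 : ℝ) ^ ((1 / 20 : ℝ) * M) ≤ complexity p := by
  obtain ⟨P, h2, hP, hsize⟩ := ArithCircuit.exists_computes_size_eq_complexity p
  calc (2 : ℝ) ^ ((1 / 20 : ℝ) * M) ≤ prodCount P := two_rpow_le_prodCount_of_support_eq hM hp h2 hP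
    _ ≤ (P.size : ℝ) := by exact_mod_cast prodCount_le_size P
    _ = complexity p := by rw [hsize]

end SupportBound

end

end Summit.ValiantsHypothesis.ValiantsHypothesis.Theorems.ZeroOneTransfer.Negative
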